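import Summits.ResolutionOfSingularities.ResolutionOfSingularities.Theorems.LossEpisode
import Summits.ResolutionOfSingularities.ResolutionOfSingularities.Theorems.LossPencil
import HarnessLib

/-!
# LossEpisodePencil — every non-R arrow leaving a run state is an `e = 2` arrow on the pencil line (kernel, score 0)

decomp-res-lens-3, gen 28.  Packages the three initial-form laws `LossExitCone.exit_initialForm` (chart `j`: X1 /
loss-(b)), `LossExitCone.switch_initialForm` (chart `l`: X2 / loss-(c)) and `LossPencil.lossA_initialForm` (chart `i`
translated: loss-(a)) over the run-state sort `LossEpisode.IsRunState`: unless the move is the untranslated R-letter, the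
initial form of `F_u` is `u^{r_u}·φ₀·(u_l − λ u_j)^s` (`φ₀ ≠ 0`) AND the centre of the move lies on the line
`{U_l = λ U_j} ⊂ ℙ(E)` — chart `j`: `(β_i : 1 : β_l)` with `β_l = λ`; chart `l`: `(β_i : β_j : 1)` with `λβ_j = 1`;
chart `i`: `(1 : β_j : β_l)` with `β_j ≠ 0`, `β_l = λβ_j`.  (F2 of NODE-g28 in kernel.)
-/

namespace Summit.ResolutionOfSingularities.ResolutionOfSingularities.Theorems.LossEpisode

open MvPolynomial Finset
open Literature.AlgebraicGeometry.Resolution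
open Literature.AlgebraicGeometry.Resolution.Hauser2010
open Literature.AlgebraicGeometry.Resolution.PointBlowup
open Summit.ResolutionOfSingularities.ResolutionOfSingularities.Theorems.TightDefectClasses
open Summit.ResolutionOfSingularities.ResolutionOfSingularities.Theorems.TightDefectStrongWalks
open Summit.ResolutionOfSingularities.ResolutionOfSingularities.Theorems.ItineraryCutClasses
open Summit.ResolutionOfSingularities.ResolutionOfSingularities.Theorems.BoundaryLedger
open Summit.ResolutionOfSingularities.ResolutionOfSingularities.Theorems.ConeCut
open Summit.ResolutionOfSingularities.ResolutionOfSingularities.Theorems.LossIsFatalLayer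
open Summit.ResolutionOfSingularities.ResolutionOfSingularities.Theorems.LossExitCone
open Summit.ResolutionOfSingularities.ResolutionOfSingularities.Theorems.LossPencil

variable {K : Type} [Field K] [DecidableEq K] {q : ℕ} {s₀ : State (Fin 3) K}

section Pencil

omit [DecidableEq K] in
/-- `u_j − β u_l = (−β)·(u_l − β⁻¹ u_j)`, raised to the `n`-th power (`β ≠ 0`). [folklore] -/
theorem linear_pow_flip (j l : Fin 3) {β : K} (hβ : β ≠ 0) (n : ℕ) :
    (X j - C β * X l : MvPolynomial (Fin 3) K) ^ n = C ((-β) ^ n) * (X l - C β⁻¹ * X j) ^ n := by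
  have hC : (C (-β) * C β⁻¹ : MvPolynomial (Fin 3) K) = -1 := by
    rw [← map_mul, neg_mul, mul_inv_cancel₀ hβ, map_neg, map_one]
  have h : (X j - C β * X l : MvPolynomial (Fin 3) K) = C (-β) * (X l - C β⁻¹ * X j) := by
    rw [mul_sub, ← mul_assoc, hC, map_neg]
    ring
  rw [h, mul_pow, ← map_pow]

variable {W : ForcedWalk q s₀} {N s : ℕ}

/-- **THE PENCIL LAW AT A RUN STATE (PROVED).**  At a run state `(i,j,l;k,m)` of the tail, unless the move at `u` is the
untranslated R-letter (`W.j u = i ∧ W.b u = 0`), there are `φ₀ ≠ 0` and `λ` with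
`coeff_{r_u+E} F_u = φ₀ · coeff_E (u_l − λ u_j)^s` for every `|E| = s` (the residual tangent cone is the `s`-fold plane
`u_l = λ u_j`, `e = 2`), and the centre of the move lies on the line `U_l = λ U_j` of `ℙ(E)`: chart `j` with `β_l = λ`
(X1 if `β_i = 0`, loss-(b) otherwise), chart `l` with `λ ≠ 0`, `β_j λ = 1` (X2 / loss-(c)), or chart `i` with `β_j ≠ 0`,
`β_l = λ β_j` (loss-(a)). [new] [folklore] -/
theorem runState_pencil (hroot : IsRoot q s₀) (hT : TailHyp W N s) {u : ℕ} (hNu : N ≤ u) {i j l : Fin 3} {k m : ℕ}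
    (hS : IsRunState W s u i j l k m) (hR : ¬ (W.j u = i ∧ W.b u = 0)) :
    ∃ φ₀ lam : K, φ₀ ≠ 0 ∧
      (∀ E : Fin 3 →₀ ℕ, E.degree = s →
        coeff ((W.st u).r + E) (W.st u).F = φ₀ * coeff E ((X l - C lam * X j) ^ s)) ∧
      ((W.j u = j ∧ W.b u l = lam) ∨ (W.j u = l ∧ lam ≠ 0 ∧ W.b u j * lam = 1) ∨
        (W.j u = i ∧ W.b u j ≠ 0 ∧ W.b u l = lam * W.b u j)) := by
  classical
  have hled := runState_ledger hroot hT hNu hS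
  have hnext := (runState_next hroot hT hNu hS).2.2.2
  obtain ⟨hij, hli, hlj, h1k, h1m, hr, c, V, hc, hV, hlayer⟩ := hS
  have hsh : (W.st u).shade = (s : ℕ∞) := hT.shade u hNu
  have hplat : (W.st (u + 1)).shade = (W.st u).shade := hled.2.2.2.2
  have hq : q < s + k + m := hled.2.1
  have ha : c * coeff 0 V ≠ 0 := mul_ne_zero hc (by rwa [← constantCoeff_eq])
  rcases fin3_eq_or i j l (W.j u) hij (fun h => hli h.symm) (fun h => hlj h.symm) with hci | hcj | hcl
  · -- chart `i`: not R, so translated off the loss wall (`runState_next`: the only other chart-`i` arrow is loss-(a))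
    have hbj : W.b u j ≠ 0 := by
      rcases hnext with hRR | hX1 | hX2 | hL
      · exact absurd ⟨hRR.1, hRR.2.1⟩ hR
      · exact absurd (hci.symm.trans hX1.1) hij
      · exact absurd (hX2.1.symm.trans hci) hli
      · rcases hL.1 with h | h | h
        · exact h.2
        · exact absurd (hci.symm.trans h.1) hij
        · exact absurd (h.1.symm.trans hci) hli
    subst hci
    refine ⟨c * coeff 0 V, W.b u l / W.b u j, ha, fun E hE => ?_, Or.inr (Or.inr ⟨rfl, hbj, ?_⟩)⟩
    · exact lossA_initialForm hroot W u hij.symm hli hlj hr hsh hplat hq hlayer hbj E hE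
    · rw [div_mul_cancel₀ _ hbj]
  · -- chart `j`: X1 / loss-(b)
    subst hcj
    refine ⟨c * coeff 0 V, W.b u l, ha, fun E hE => ?_, Or.inl ⟨rfl, rfl⟩⟩
    exact exit_initialForm hroot W u hij hlj hr hsh hplat hq hlayer E hE
  · -- chart `l`: X2 / loss-(c); `switch_law` forces `β_j ≠ 0`
    subst hcl
    have hbj : W.b u j ≠ 0 := (switch_law hroot W u hli.symm hlj.symm hij hr hsh hplat hq hT.one_le ha hlayer).2.1
    refine ⟨c * coeff 0 V, (W.b u j)⁻¹, ha, fun E hE => ?_, Or.inr (Or.inl ⟨rfl, inv_ne_zero hbj, mul_inv_cancel₀ hbj⟩)⟩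
    rw [switch_initialForm hroot W u hli.symm hlj.symm hij hr hsh hplat hq hT.one_le ha hlayer E hE,
      linear_pow_flip j (W.j u) hbj, coeff_C_mul, ← mul_assoc, div_mul_cancel₀ _ (pow_ne_zero _ (neg_ne_zero.mpr hbj))]

end Pencil

end Summit.ResolutionOfSingularities.ResolutionOfSingularities.Theorems.LossEpisode
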